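import Literature.Analysis.Complex.LoewnerFastTrackLoewnerMatrix
import HarnessLib

/-!
# Loewner's theorem, Part I — step 3: Löwner's characterization, sufficiency
# (Hansen 2013, Theorem 3.2 `⇐`): positive semidefinite Loewner matrices imply matrix
# monotonicity

Third brick of the hard direction (`→`) of `Literature.Analysis.Complex.loewner_theorem` along
Hansen's fast track [Hansen2013] (this direction of Theorem 3.2 is what the Bendat–Sherman theorem,
Hansen's Theorem 3.6, consumes). Main result:

* `matrixMonotone_of_loewner_matrix_posSemidef` — if `f ∈ C¹(a, b)` has positive semidefinite
  Loewner matrices `([dᵢ, dⱼ]_f)` at all node tuples `d₁, …, dₙ ∈ (a, b)`, then `f` is `n`-monotone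
  on `(a, b)` (Hermitian `A ≤ B` with spectra in `(a, b)` ⇒ `f(A) ≤ f(B)`).

Hansen integrates the first-order formula `d/dt ⟨f(x + th)ξ, ξ⟩ = ⟨(h ∘ L)ξ, ξ⟩` along the segment
from `A` to `B` and uses the Schur product theorem. As in step 2 we keep the matrix calculus
algebraic: for polynomials `p` the derivative of `τ ↦ ξ⋆p(A + τ(B - A))ξ` is computed exactly from
the telescoping form and its unitary equivariance (`re_quadForm_aeval_sub_aeval_ge`: in the
eigenbasis of `x_τ` it is `η⋆(H̃ ∘ L_p(λ(τ)))η`, and `H̃ ∘ L_f ≥ 0` by Mathlib's Schur product theorem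
`Matrix.PosSemidef.hadamard`, while `|L_p - L_f| ≤ δ` entrywise when `|p' - f'| ≤ δ`); the mean
value inequality replaces the integral, and `pₖ → f` in `C¹` (Weierstrass) passes to the limit in
the spectral quadratic forms.
-/

noncomputable section

open scoped ComplexOrder ComplexConjugate MatrixOrder Matrix.Norms.L2Operator
open Complex Set Filter Topology Metric Real Matrix Polynomial

namespace Literature.Analysis.Complex

section LoewnerSufficiency

variable {m : Type*} [Fintype m] [DecidableEq m]

/-- A Hermitian matrix with real spectrum in `[c, ∞)` dominates `c`. [folklore] -/
theorem posSemidef_sub_smul_one_of_spectrum_subset_Ici {M : Matrix m m ℂ} (hM : M.IsHermitian)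
    {c : ℝ} (h : spectrum ℝ M ⊆ Ici c) : (M - (c : ℂ) • 1).PosSemidef := by
  rw [Matrix.posSemidef_iff_isHermitian_and_spectrum_nonneg]
  refine ⟨hM.sub (by unfold Matrix.IsHermitian; rw [conjTranspose_smul, conjTranspose_one]; simp),
    fun z hz => ?_⟩
  have : (M - (c : ℂ) • (1 : Matrix m m ℂ)) = M - algebraMap ℂ (Matrix m m ℂ) (c : ℂ) := by
    rw [Algebra.algebraMap_eq_smul_one]
  rw [this, ← spectrum.sub_singleton_eq] at hz
  obtain ⟨w, hw, c', hc', rfl⟩ := hz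
  rw [mem_singleton_iff] at hc'
  subst hc'
  have hwreal : w ∈ spectrum ℂ M := hw
  rw [hM.spectrum_eq_image_range] at hwreal
  obtain ⟨r, ⟨i, rfl⟩, rfl⟩ := hwreal
  have hr : hM.eigenvalues i ∈ spectrum ℝ M := hM.eigenvalues_mem_spectrum_real i
  have := h hr
  simp only [mem_setOf_eq]
  have e : (↑(hM.eigenvalues i) : ℂ) - (c : ℂ) = ((hM.eigenvalues i - c : ℝ) : ℂ) := by push_cast; rfl
  have hle : c ≤ hM.eigenvalues i := mem_Ici.mp this
  calc (0 : ℂ) ≤ ((hM.eigenvalues i - c : ℝ) : ℂ) := Complex.zero_le_real.mpr (by linarith)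
    _ = _ := by rw [← e]; rfl

/-- A Hermitian matrix with real spectrum in `(-∞, c]` is dominated by `c`. [folklore] -/
theorem posSemidef_smul_one_sub_of_spectrum_subset_Iic {M : Matrix m m ℂ} (hM : M.IsHermitian)
    {c : ℝ} (h : spectrum ℝ M ⊆ Iic c) : ((c : ℂ) • 1 - M).PosSemidef := by
  have hneg : (-M).IsHermitian := hM.neg
  have hsp : spectrum ℝ (-M) ⊆ Ici (-c) := by
    intro r hr
    rw [← spectrum.neg_eq] at hr
    have := h hr
    simp only [mem_Iic] at this
    simp only [mem_Ici]; linarith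
  have := posSemidef_sub_smul_one_of_spectrum_subset_Ici hneg hsp
  have e : -M - ((-c : ℝ) : ℂ) • (1 : Matrix m m ℂ) = (c : ℂ) • 1 - M := by
    push_cast; rw [neg_smul]; abel
  rwa [e] at this

omit [DecidableEq m] in
/-- The quadratic form of a conjugated matrix: `ξ⋆(U S U⋆)ξ = (U⋆ξ)⋆ S (U⋆ξ)`. [folklore] -/
theorem star_dotProduct_conj_mulVec (U S : Matrix m m ℂ) (ξ : m → ℂ) :
    star ξ ⬝ᵥ ((U * S * star U) *ᵥ ξ) = star (star U *ᵥ ξ) ⬝ᵥ (S *ᵥ (star U *ᵥ ξ)) := by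
  rw [← mulVec_mulVec, ← mulVec_mulVec, dotProduct_mulVec]
  congr 1
  rw [star_mulVec, star_eq_conjTranspose, conjTranspose_conjTranspose]

omit [DecidableEq m] in
/-- Error bound for a Hadamard-type quadratic form with small entries:
`|η⋆ (H̃ ⊙ E) η| ≤ δ (max |H̃|) (∑|ηᵢ|)²` when `|Eᵢⱼ| ≤ δ`. [folklore] -/
theorem norm_star_dotProduct_hadamard_mulVec_le {H E : Matrix m m ℂ} {δ K : ℝ}
    (hK : 0 ≤ K) (hE : ∀ i j, ‖E i j‖ ≤ δ) (hH : ∀ i j, ‖H i j‖ ≤ K) (η : m → ℂ) :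
    ‖star η ⬝ᵥ ((H ⊙ E) *ᵥ η)‖ ≤ δ * K * (∑ i, ‖η i‖) ^ 2 := by
  simp only [dotProduct, mulVec, hadamard_apply, Pi.star_apply, Finset.mul_sum]
  calc ‖∑ i, ∑ j, star (η i) * (H i j * E i j * η j)‖
      ≤ ∑ i, ∑ j, ‖star (η i) * (H i j * E i j * η j)‖ :=
        (norm_sum_le _ _).trans (Finset.sum_le_sum fun i _ => norm_sum_le _ _)
    _ ≤ ∑ i, ∑ j, ‖η i‖ * (K * δ * ‖η j‖) := by
        refine Finset.sum_le_sum fun i _ => Finset.sum_le_sum fun j _ => ?_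
        rw [norm_mul, norm_star, norm_mul, norm_mul]
        gcongr
        · exact hH i j
        · exact hE i j
    _ = δ * K * (∑ i, ‖η i‖) ^ 2 := by
        rw [sq, Finset.sum_mul_sum]
        simp only [Finset.mul_sum]
        refine Finset.sum_congr rfl fun i _ => Finset.sum_congr rfl fun j _ => ?_
        ring

end LoewnerSufficiency

section LoewnerSufficiencyMain

/-- **Polynomial step for sufficiency** (Hansen 2013, Theorem 3.2, `⇐`, quantitative): if the
Loewner matrices of `f` at all node tuples of `(a, b)` are positive semidefinite and `p` is a
polynomial with `|L_p - L_f| ≤ δ` entrywise on `[a', b']² ⊆ (a, b)²` (guaranteed by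
`|p' - f'| ≤ δ`), then for Hermitian `A ≤ B` with spectra in `[a', b']`,
`Re ξ⋆(p(B) - p(A))ξ ≥ -δ (∑ₖₗ |(B - A)ₖₗ|) (∑|ξᵢ|)²`: along `x_τ = A + τ(B - A)` the derivative of
`τ ↦ ξ⋆p(x_τ)ξ` is `η⋆(H̃ ∘ L_p(λ(τ)))η` in the eigenbasis of `x_τ`, and `H̃ ∘ L_f ≥ 0` by the Schur
product theorem. [cite: Hansen2013, Theorem 3.2] -/
theorem re_quadForm_aeval_sub_aeval_ge {n : ℕ} {a b a' b' : ℝ} (hJ : Icc a' b' ⊆ Ioo a b)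
    {f f' : ℝ → ℝ} (hf : ∀ x ∈ Icc a' b', HasDerivAt f (f' x) x)
    (hL : ∀ d : Fin n → ℝ, (∀ i, d i ∈ Ioo a b) →
      (Matrix.of fun i j : Fin n => ((if d i = d j then f' (d i)
        else slope f (d j) (d i) : ℝ) : ℂ)).PosSemidef)
    (p : ℝ[X]) {δ : ℝ} (hδ : 0 ≤ δ) (hp' : ∀ x ∈ Icc a' b', |p.derivative.eval x - f' x| ≤ δ)
    {A B : Matrix (Fin n) (Fin n) ℂ} (hA : A.IsHermitian) (hB : B.IsHermitian)
    (hAs : spectrum ℝ A ⊆ Icc a' b') (hBs : spectrum ℝ B ⊆ Icc a' b') (hAB : (B - A).PosSemidef)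
    (ξ : Fin n → ℂ) :
    -(δ * (∑ k, ∑ l, ‖(B - A) k l‖) * ((n : ℝ) * ∑ i, ‖ξ i‖) ^ 2) ≤
      (star ξ ⬝ᵥ ((aeval B p - aeval A p) *ᵥ ξ)).re := by
  set H : Matrix (Fin n) (Fin n) ℂ := B - A with hH
  set K : ℝ := ∑ k, ∑ l, ‖H k l‖ with hK
  have hK0 : 0 ≤ K := Finset.sum_nonneg fun k _ => Finset.sum_nonneg fun l _ => norm_nonneg _
  set T : ℝ := ∑ i, ‖ξ i‖ with hT
  -- the segment `x_τ`
  set xτ : ℝ → Matrix (Fin n) (Fin n) ℂ := fun τ => A + (τ : ℂ) • H with hxτ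
  have hxh : ∀ τ, (xτ τ).IsHermitian := by
    intro τ
    rw [hxτ]; dsimp only
    refine hA.add ?_
    unfold Matrix.IsHermitian; rw [conjTranspose_smul, hH, (hB.sub hA).eq]; simp
  have hxsp : ∀ τ ∈ Icc (0 : ℝ) 1, spectrum ℝ (xτ τ) ⊆ Icc a' b' := by
    intro τ hτ r hr
    have hlo : spectrum ℝ (xτ τ) ⊆ Ici a' := by
      apply spectrum_subset_Ici_of_posSemidef_sub
      have e : xτ τ - (a' : ℂ) • 1 = ((1 - τ : ℝ) : ℂ) • (A - (a' : ℂ) • 1) + (τ : ℂ) • (B - (a' : ℂ) • 1) := by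
        rw [hxτ]; dsimp only; rw [hH]; push_cast; module
      rw [e]
      refine PosSemidef.add ?_ ?_
      · have : ((1 - τ : ℝ) : ℂ) • (A - (a' : ℂ) • 1) = (1 - τ) • (A - (a' : ℂ) • 1) := rfl
        rw [this]
        exact (posSemidef_sub_smul_one_of_spectrum_subset_Ici hA
          (fun r hr => (hAs hr).1)).smul (by linarith [hτ.2])
      · have : ((τ : ℝ) : ℂ) • (B - (a' : ℂ) • 1) = τ • (B - (a' : ℂ) • 1) := rfl
        rw [this]
        exact (posSemidef_sub_smul_one_of_spectrum_subset_Ici hB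
          (fun r hr => (hBs hr).1)).smul hτ.1
    have hhi : spectrum ℝ (xτ τ) ⊆ Iic b' := by
      apply spectrum_subset_Iic_of_posSemidef_sub'
      have e : (b' : ℂ) • 1 - xτ τ = ((1 - τ : ℝ) : ℂ) • ((b' : ℂ) • 1 - A) + (τ : ℂ) • ((b' : ℂ) • 1 - B) := by
        rw [hxτ]; dsimp only; rw [hH]; push_cast; module
      rw [e]
      refine PosSemidef.add ?_ ?_
      · have : ((1 - τ : ℝ) : ℂ) • ((b' : ℂ) • 1 - A) = (1 - τ) • ((b' : ℂ) • 1 - A) := rfl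
        rw [this]
        exact (posSemidef_smul_one_sub_of_spectrum_subset_Iic hA
          (fun r hr => (hAs hr).2)).smul (by linarith [hτ.2])
      · have : ((τ : ℝ) : ℂ) • ((b' : ℂ) • 1 - B) = τ • ((b' : ℂ) • 1 - B) := rfl
        rw [this]
        exact (posSemidef_smul_one_sub_of_spectrum_subset_Iic hB
          (fun r hr => (hBs hr).2)).smul hτ.1
    exact ⟨hlo hr, hhi hr⟩
  -- the telescoping form of `p` and the function `φ(τ) = ξ⋆ p(x_τ) ξ`
  obtain ⟨Bf, hB1, hB2, hB3, hB5, hB4⟩ := exists_telescoping_form (m := Fin n) p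
  set φ : ℝ → ℂ := fun τ => star ξ ⬝ᵥ (aeval (xτ τ) p *ᵥ ξ) with hφ
  set φ' : ℝ → ℂ := fun τ => star ξ ⬝ᵥ (Bf (xτ τ) (xτ τ) H *ᵥ ξ) with hφ'
  have hderiv : ∀ τ, HasDerivAt φ (φ' τ) τ := by
    intro τ
    rw [hasDerivAt_iff_tendsto_slope]
    have hslope : ∀ σ, σ ≠ τ → slope φ τ σ = star ξ ⬝ᵥ (Bf (xτ σ) (xτ τ) H *ᵥ ξ) := by
      intro σ hσ
      rw [slope_def_module, hφ]
      dsimp only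
      have hdiff : xτ σ - xτ τ = ((σ - τ : ℝ) : ℂ) • H := by
        rw [hxτ]; dsimp only; push_cast; module
      rw [← dotProduct_sub, ← sub_mulVec, hB1 (xτ τ) (xτ σ), hdiff, hB3, Matrix.smul_mulVec,
        dotProduct_smul]
      have hne : ((σ : ℂ) - (τ : ℂ)) ≠ 0 := by
        rw [← ofReal_sub]; exact ofReal_ne_zero.2 (sub_ne_zero.2 hσ)
      simp only [smul_eq_mul, Complex.real_smul, ofReal_inv, ofReal_sub]
      field_simp
    have hcont : Tendsto (fun σ => star ξ ⬝ᵥ (Bf (xτ σ) (xτ τ) H *ᵥ ξ)) (𝓝 τ)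
        (𝓝 (star ξ ⬝ᵥ (Bf (xτ τ) (xτ τ) H *ᵥ ξ))) := by
      have hx_cont : Continuous xτ := by
        rw [hxτ]
        exact continuous_const.add ((continuous_ofReal).smul continuous_const)
      have h1 : Tendsto (fun σ => Bf (xτ σ) (xτ τ) H) (𝓝 τ) (𝓝 (Bf (xτ τ) (xτ τ) H)) :=
        ((hB2 (xτ τ) H).comp hx_cont).tendsto τ
      exact tendsto_star_dotProduct_mulVec (fun i j =>
        ((continuous_apply j).comp (continuous_apply i)).continuousAt.tendsto.comp h1) ξ
    refine (hcont.mono_left nhdsWithin_le_nhds).congr' ?_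
    filter_upwards [self_mem_nhdsWithin] with σ hσ
    exact (hslope σ hσ).symm
  -- the real function `ψ = Re φ` and its derivative bound
  set ψ : ℝ → ℝ := fun τ => (φ τ).re with hψ
  have hψderiv : ∀ τ, HasDerivAt ψ ((φ' τ).re) τ := fun τ =>
    (Complex.reCLM.hasFDerivAt.comp_hasDerivAt τ (hderiv τ))
  have hbound : ∀ τ ∈ Icc (0 : ℝ) 1, -(δ * K * ((n : ℝ) * T) ^ 2) ≤ (φ' τ).re := by
    intro τ hτ
    -- diagonalise `x_τ`
    have hx := hxh τ
    set U : Matrix (Fin n) (Fin n) ℂ :=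
      ((hx.eigenvectorUnitary : Matrix.unitaryGroup (Fin n) ℂ) : Matrix (Fin n) (Fin n) ℂ) with hU
    have hUu : U ∈ Matrix.unitaryGroup (Fin n) ℂ := hx.eigenvectorUnitary.2
    set lam : Fin n → ℝ := hx.eigenvalues with hlam
    have hxdec : xτ τ = U * diagonal (fun i => (lam i : ℂ)) * star U := by
      have := hx.spectral_theorem
      rw [Unitary.conjStarAlgAut_apply] at this
      exact this
    have hlamJ : ∀ i, lam i ∈ Icc a' b' := fun i => hxsp τ hτ (hx.eigenvalues_mem_spectrum_real i)
    -- the derivative in the eigenbasis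
    set Ht : Matrix (Fin n) (Fin n) ℂ := star U * H * U with hHt
    set η : Fin n → ℂ := star U *ᵥ ξ with hη
    set Lp : Matrix (Fin n) (Fin n) ℂ := Matrix.of fun i j : Fin n =>
      ((if lam i = lam j then p.derivative.eval (lam i)
        else slope (fun x => p.eval x) (lam j) (lam i) : ℝ) : ℂ) with hLp
    set Lf : Matrix (Fin n) (Fin n) ℂ := Matrix.of fun i j : Fin n =>
      ((if lam i = lam j then f' (lam i) else slope f (lam j) (lam i) : ℝ) : ℂ) with hLf
    have hS : Bf (diagonal (fun i => (lam i : ℂ))) (diagonal (fun i => (lam i : ℂ))) Ht = Ht ⊙ Lp := by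
      ext i j
      rw [hB4 lam Ht i j, hadamard_apply, hLp, Matrix.of_apply]
    have hφ'eq : φ' τ = star η ⬝ᵥ ((Ht ⊙ Lp) *ᵥ η) := by
      rw [hφ']; dsimp only
      rw [hxdec, hB5 U hUu, star_dotProduct_conj_mulVec, hS]
    -- Schur product with the (PSD) Loewner matrix of `f`
    have hHtpsd : Ht.PosSemidef := by
      rw [hHt, show star U = Uᴴ from star_eq_conjTranspose U]
      exact hAB.conjTranspose_mul_mul_same U
    have hLfpsd : Lf.PosSemidef := hL lam fun i => hJ (hlamJ i)
    have hmain : 0 ≤ (star η ⬝ᵥ ((Ht ⊙ Lf) *ᵥ η)).re :=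
      (Complex.le_def.mp ((hHtpsd.hadamard hLfpsd).dotProduct_mulVec_nonneg η)).1
    -- the error `Ht ⊙ (Lp - Lf)`
    have hE : ∀ i j, ‖(Lp - Lf) i j‖ ≤ δ := by
      intro i j
      rw [Matrix.sub_apply, hLp, hLf, Matrix.of_apply, Matrix.of_apply, ← ofReal_sub, Complex.norm_real,
        Real.norm_eq_abs]
      have hgder : ∀ u ∈ Icc a' b', HasDerivAt (fun u => p.eval u - f u)
          (p.derivative.eval u - f' u) u := fun u hu => (Polynomial.hasDerivAt p u).sub (hf u hu)
      split_ifs with hij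
      · exact hp' _ (hlamJ i)
      · have h1 := abs_sub_le_of_deriv_bound hgder hp' (hlamJ i) (hlamJ j)
        rw [slope_def_field, slope_def_field, ← sub_div, abs_div]
        rw [div_le_iff₀ (abs_pos.2 (sub_ne_zero.2 hij))]
        calc |eval (lam i) p - eval (lam j) p - (f (lam i) - f (lam j))|
            = |eval (lam i) p - f (lam i) - (eval (lam j) p - f (lam j))| := by ring_nf
          _ ≤ δ * |lam i - lam j| := h1
    have hHK : ∀ i j, ‖Ht i j‖ ≤ K := fun i j => by
      rw [hHt, hK]
      exact norm_conjTranspose_mul_mul_apply_le hUu hUu H i j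
    have herr := norm_star_dotProduct_hadamard_mulVec_le hK0 hE hHK η
    have hηT : (∑ i, ‖η i‖) ≤ (Fintype.card (Fin n) : ℝ) * T := by
      calc (∑ i, ‖η i‖) ≤ ∑ i : Fin n, T := Finset.sum_le_sum fun i _ =>
            norm_conjTranspose_mulVec_apply_le hUu ξ i
        _ = (Fintype.card (Fin n) : ℝ) * T := by
            rw [Finset.sum_const, Finset.card_univ, nsmul_eq_mul]
    rw [Fintype.card_fin] at hηT
    have hsplit : φ' τ = star η ⬝ᵥ ((Ht ⊙ Lf) *ᵥ η) + star η ⬝ᵥ ((Ht ⊙ (Lp - Lf)) *ᵥ η) := by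
      rw [hφ'eq, ← dotProduct_add, ← add_mulVec, ← hadamard_add]
      congr 2; abel
    rw [hsplit, add_re]
    have hre_err : -(δ * K * ((n : ℝ) * T) ^ 2) ≤ (star η ⬝ᵥ ((Ht ⊙ (Lp - Lf)) *ᵥ η)).re := by
      have h1 := (abs_le.mp ((Complex.abs_re_le_norm _).trans herr)).1
      have h2 : δ * K * (∑ i, ‖η i‖) ^ 2 ≤ δ * K * ((n : ℝ) * T) ^ 2 := by
        have hη0 : 0 ≤ ∑ i, ‖η i‖ := Finset.sum_nonneg fun i _ => norm_nonneg _
        gcongr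
      linarith
    linarith
  -- mean value inequality for `ψ` on `[0, 1]`
  have hmvt := (convex_Icc (0 : ℝ) 1).mul_sub_le_image_sub_of_le_deriv
    (fun τ _ => (hψderiv τ).continuousAt.continuousWithinAt)
    (fun τ _ => (hψderiv τ).differentiableAt.differentiableWithinAt)
    (C := -(δ * K * ((n : ℝ) * T) ^ 2)) (fun τ hτ => by
      rw [(hψderiv τ).deriv]
      exact hbound τ (interior_subset hτ))
    0 (left_mem_Icc.2 zero_le_one) 1 (right_mem_Icc.2 zero_le_one) zero_le_one
  have hx0 : xτ 0 = A := by rw [hxτ]; simp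
  have hx1 : xτ 1 = B := by rw [hxτ]; dsimp only; rw [hH]; push_cast; module
  rw [sub_zero, mul_one, hψ] at hmvt
  dsimp only at hmvt
  rw [hφ] at hmvt
  dsimp only at hmvt
  rw [hx0, hx1, ← sub_re, ← dotProduct_sub, ← sub_mulVec] at hmvt
  rw [hK, hT] at hmvt
  exact hmvt

end LoewnerSufficiencyMain

section LoewnerSufficiencyFinal

/-- Quadratic forms of polynomial calculi converge to those of `cfc f` when the polynomials
converge to `f` pointwise on the spectrum. [folklore] -/
theorem tendsto_re_quadForm_aeval {n : ℕ} {M : Matrix (Fin n) (Fin n) ℂ} (hM : M.IsHermitian)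
    {p : ℕ → ℝ[X]} {f : ℝ → ℝ}
    (hlim : ∀ x ∈ spectrum ℝ M, Tendsto (fun k => (p k).eval x) atTop (𝓝 (f x))) (ξ : Fin n → ℂ) :
    Tendsto (fun k => (star ξ ⬝ᵥ (aeval M (p k) *ᵥ ξ)).re) atTop
      (𝓝 ((star ξ ⬝ᵥ (cfc f M *ᵥ ξ)).re)) := by
  have hM' : IsSelfAdjoint M := hM
  have h1 : ∀ k, aeval M (p k) = cfc (fun x => (p k).eval x) M := fun k =>
    (cfc_polynomial (p k) M hM').symm
  simp_rw [h1, star_dotProduct_cfc_mulVec hM, ofReal_re]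
  exact tendsto_finsetSum _ fun i _ =>
    (hlim _ (hM.eigenvalues_mem_spectrum_real i)).mul_const _

/-- **Löwner's characterization, sufficiency** (Löwner 1934; Hansen 2013, Theorem 3.2, `⇐`):
if `f ∈ C¹(a, b)` has positive semidefinite Loewner matrices `([dᵢ, dⱼ]_f)ᵢⱼ` at all node tuples
`d₁, …, dₙ ∈ (a, b)`, then `f` is `n`-monotone on `(a, b)`. The matrix calculus is kept algebraic:
`pₖ → f` in `C¹` (Weierstrass), the polynomial step `re_quadForm_aeval_sub_aeval_ge`, and a limit
in the spectral quadratic forms. [cite: Hansen2013, Theorem 3.2] -/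
theorem matrixMonotone_of_loewner_matrix_posSemidef {f f' : ℝ → ℝ} {a b : ℝ}
    (hf : ∀ x ∈ Ioo a b, HasDerivAt f (f' x) x) (hf' : ContinuousOn f' (Ioo a b)) {n : ℕ}
    (hL : ∀ d : Fin n → ℝ, (∀ i, d i ∈ Ioo a b) →
      (Matrix.of fun i j : Fin n => ((if d i = d j then f' (d i)
        else slope f (d j) (d i) : ℝ) : ℂ)).PosSemidef)
    (A B : Matrix (Fin n) (Fin n) ℂ) (hA : A.IsHermitian) (hB : B.IsHermitian)
    (hAs : spectrum ℝ A ⊆ Ioo a b) (hBs : spectrum ℝ B ⊆ Ioo a b) (hAB : (B - A).PosSemidef) :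
    (cfc f B - cfc f A).PosSemidef := by
  have hherm : (cfc f B - cfc f A).IsHermitian := by
    have h1 : IsSelfAdjoint (cfc f B) := cfc_predicate f B
    have h2 : IsSelfAdjoint (cfc f A) := cfc_predicate f A
    exact h1.sub h2
  cases n with
  | zero =>
    refine PosSemidef.of_dotProduct_mulVec_nonneg hherm fun ξ => ?_
    simp [dotProduct]
  | succ N =>
    -- a compact interval `[a', b'] ⊆ (a, b)` containing both spectra
    have hfinA := Matrix.finite_real_spectrum (A := A)
    have hfinB := Matrix.finite_real_spectrum (A := B)
    set S : Finset ℝ := (hfinA.union hfinB).toFinset with hS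
    have hSne : S.Nonempty := ⟨hA.eigenvalues 0, by
      rw [hS, Set.Finite.mem_toFinset]; exact Or.inl (hA.eigenvalues_mem_spectrum_real 0)⟩
    set M : ℝ := S.sup' hSne id with hM
    set L : ℝ := S.inf' hSne id with hL'
    have hmemS : ∀ r, r ∈ spectrum ℝ A ∪ spectrum ℝ B → r ∈ S := fun r hr => by
      rw [hS, Set.Finite.mem_toFinset]; exact hr
    have hleM : ∀ r ∈ spectrum ℝ A ∪ spectrum ℝ B, r ≤ M := fun r hr =>
      Finset.le_sup' id (hmemS r hr)
    have hgeL : ∀ r ∈ spectrum ℝ A ∪ spectrum ℝ B, L ≤ r := fun r hr =>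
      Finset.inf'_le id (hmemS r hr)
    have hMb : M < b := by
      obtain ⟨r, hr, hrM⟩ := Finset.exists_mem_eq_sup' hSne id
      rw [hM, hrM]
      rw [hS, Set.Finite.mem_toFinset] at hr
      rcases hr with hr | hr
      · exact (hAs hr).2
      · exact (hBs hr).2
    have hLa : a < L := by
      obtain ⟨r, hr, hrL⟩ := Finset.exists_mem_eq_inf' hSne id
      rw [hL', hrL]
      rw [hS, Set.Finite.mem_toFinset] at hr
      rcases hr with hr | hr
      · exact (hAs hr).1
      · exact (hBs hr).1
    set a' : ℝ := (a + L) / 2 with ha'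
    set b' : ℝ := (M + b) / 2 with hb'
    have hJ : Icc a' b' ⊆ Ioo a b := fun x hx => ⟨by linarith [hx.1], by linarith [hx.2]⟩
    have hAs' : spectrum ℝ A ⊆ Icc a' b' := fun r hr =>
      ⟨by linarith [hgeL r (Or.inl hr)], by linarith [hleM r (Or.inl hr)]⟩
    have hBs' : spectrum ℝ B ⊆ Icc a' b' := fun r hr =>
      ⟨by linarith [hgeL r (Or.inr hr)], by linarith [hleM r (Or.inr hr)]⟩
    have hab' : a' ≤ b' := by
      have h := hAs' (hA.eigenvalues_mem_spectrum_real 0)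
      exact h.1.trans h.2
    have hfJ : ∀ x ∈ Icc a' b', HasDerivAt f (f' x) x := fun x hx => hf x (hJ hx)
    have hf'J : ContinuousOn f' (Icc a' b') := hf'.mono hJ
    -- polynomial approximants
    have happrox : ∀ k : ℕ, ∃ p : ℝ[X], (∀ x ∈ Icc a' b', |p.eval x - f x| ≤ 1 / ((k : ℝ) + 1)) ∧
        ∀ x ∈ Icc a' b', |p.derivative.eval x - f' x| ≤ 1 / ((k : ℝ) + 1) := fun k =>
      exists_polynomial_near_with_derivative hab' hfJ hf'J (by positivity)
    choose p hp hp' using happrox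
    have hδ_lim : Tendsto (fun k : ℕ => 1 / ((k : ℝ) + 1)) atTop (𝓝 0) :=
      tendsto_one_div_add_atTop_nhds_zero_nat
    have hnode : ∀ u ∈ Icc a' b', Tendsto (fun k => (p k).eval u) atTop (𝓝 (f u)) := by
      intro u hu
      refine tendsto_iff_norm_sub_tendsto_zero.mpr ?_
      refine squeeze_zero (fun k => norm_nonneg _) (fun k => ?_) hδ_lim
      rw [Real.norm_eq_abs]; exact hp k u hu
    -- the limit
    refine posSemidef_of_re_star_dotProduct_mulVec_nonneg hherm fun ξ => ?_
    have hupper : Tendsto (fun k => (star ξ ⬝ᵥ ((aeval B (p k) - aeval A (p k)) *ᵥ ξ)).re) atTop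
        (𝓝 ((star ξ ⬝ᵥ ((cfc f B - cfc f A) *ᵥ ξ)).re)) := by
      have h := (tendsto_re_quadForm_aeval hB (fun x hx => hnode x (hBs' hx)) ξ).sub
        (tendsto_re_quadForm_aeval hA (fun x hx => hnode x (hAs' hx)) ξ)
      simp only [sub_mulVec, dotProduct_sub, sub_re] at h ⊢
      exact h
    set C : ℝ := (∑ k, ∑ l, ‖(B - A) k l‖) * (((N + 1 : ℕ) : ℝ) * ∑ i, ‖ξ i‖) ^ 2 with hC
    have hlower : Tendsto (fun k : ℕ => -(1 / ((k : ℝ) + 1) * C)) atTop (𝓝 0) := by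
      have := (hδ_lim.mul_const C).neg
      simpa using this
    refine le_of_tendsto_of_tendsto' hlower hupper fun k => ?_
    have h := re_quadForm_aeval_sub_aeval_ge hJ hfJ hL (p k) (by positivity) (hp' k) hA hB hAs'
      hBs' hAB ξ
    rw [hC]
    have e : 1 / ((k : ℝ) + 1) * ((∑ k, ∑ l, ‖(B - A) k l‖) * (((N + 1 : ℕ) : ℝ) * ∑ i, ‖ξ i‖) ^ 2)
        = 1 / ((k : ℝ) + 1) * (∑ k, ∑ l, ‖(B - A) k l‖) * (((N + 1 : ℕ) : ℝ) * ∑ i, ‖ξ i‖) ^ 2 := by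
      ring
    rw [e]
    exact h

end LoewnerSufficiencyFinal

end Literature.Analysis.Complex
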